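import Literature.MathematicalPhysics.QuantumFieldTheory.Balaban1983to89.B9Thm311SmallFieldCoercivityUniform
import Literature.MathematicalPhysics.QuantumFieldTheory.Balaban1983to89.B9Thm311SmallFieldGreen
import Literature.MathematicalPhysics.QuantumFieldTheory.Balaban1983to89.B9Eq319CentreLiftL2
import Literature.MathematicalPhysics.QuantumFieldTheory.Balaban1983to89.B9Eq383QSemiLocal

/-!
# `Balaban1983to89.B9Thm311SmallFieldClosedUniform` — T. Bałaban, *Propagators for lattice gauge theories in a background field*, Commun. Math.
# Phys. **99** (1985) 389–434 [Balaban1985BackgroundPropagators] Thm 3.11 p. 416 with (3.69) p. 404, (3.78)–(3.86) pp. 406–407: THM 3.11 «Δ_a IS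
# POSITIVE DEFINITE» FOR THE pub-balaban NE9 CHAIN'S ASSEMBLED `Δ_a(U)` AT EVERY SMALL FIELD, THE SMALLNESS THRESHOLDS `ε₂`, `ε₃` CHOSEN BEFORE THE
# VOLUME — the OWNER's `B9Thm311SmallFieldClosed` with `∃` in front of `∀ m`

statement-level skeleton of published theorems with citation tags; proofs where landed; nothing here is a claim about the Yang–Mills mass gap

PDF held: `paper:balaban1985-cmp99-background-propagators` pp. 404–407, 416 via the OWNER's `B9Thm311SmallFieldClosed` ∕ `B9Thm311SmallFieldCoercivity`
docstrings (verbatim there); [Balaban1984PropagatorsI] p. 33 read first-hand by this seat (2026-08-22).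

THE PRINT (verbatim).  [B9] p. 416: *«Theorem 3.11. … the operators Δ′_a, G′, (Q′G′²Q′*)⁻¹, Δ_a, G are positive definite.»*; p. 406 on the
averaging remainders: *«a constant O(1) depending on d and L only»* (quoted in `B9Eq319CentreLiftL2`).

WHY THIS FILE (cell context).  The OWNER's (E) `B9Thm311SmallFieldClosed` (p315849) closes (C2)'s displayed averaging remainders per lattice with
`ρ′ := ((1+ε_R)^{d(L−1)} − 1)∕√c₀` in SUP currency (then `× C_S = L^d√(c₀·#sites)` inside (C2)) and `δ_Q := M_φ′M_φ√(c₁·#bonds∕c₀)·102(d+1)²L·ε`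
(`B9Eq315QLipschitz`) — both VOLUME factors.  With `B9Thm311SmallFieldCoercivityUniform` (γ, ε₀ before `m`; `Q′`-closeness in the centre-lift
currency) the volume-free leaf letters close the same remainders for every `m` at once: `B9Eq319CentreLiftL2.norm_centreLift_QprimeW_sub_flat_le_
linear` (`ρ = √(L^d)·d(L−1)·2^{d(L−1)}·ε_R`, ne9-leaf-03 gen 58) and `B9Eq383QSemiLocal.norm_QtorusW_sub_flat_le_local` (`δ_Q = M_φ′M_φ√(2d·c₁∕c₀)·
102(d+1)²L·ε`, ne9-leaf-04 gen 69); the curvature step of (E) §3 (`B9Ineq369CurvatureSmall`, constant `32d·C_τ·M_φ²·(|η|^d∕c₀)·|η|⁻²`) never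
depended on the volume.

WHAT IS PROVED (sorry-free; 0 `def`; no inequality of the papers asserted).
* §8 **`exists_coercive_principal_of_small_field_uniform₀`**: `∃ γ ε₂ > 0, ∀ m, ∀ U` (E162 data, `‖U(b) − 1‖ ≤ ε ≤ ε₂`, `hRS`): `γ‖x‖² ≤ re⟨x,
  Δ_prin(U)x⟩` — NO displayed remainder; **`laplaceAofBackground_pos_of_small_field_uniform`**: `∃ ε₃ > 0, ∀ m, ∀ U` (same data, `ε ≤ ε₃`), `∀ x ≠ 0,
  0 < re⟨x, laplaceAofBackground L m hL φ U hα1 hU1 hreg τ η a x⟩` — the displayed `hpos` of `B9Eq315QTorus` ∕ `Support/NE9CurChartOfBackground` as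
  a theorem with a volume-free threshold; `laplaceAofBackground_pos_of_small_field_uniform_unitary` (`hRS` discharged by the model letters,
  `B9Thm311SmallFieldClosed.hRS_of_unitary`).  Proofs = the OWNER's (E) §2–§3 VERBATIM with the two volume-free letters substituted.
* §9 **`exists_coercive_laplaceA_of_small_field_uniform`**, **`norm_G1_le_of_small_field_uniform`** — the OWNER's (F) `B9Thm311SmallFieldGreen` pair
  (the FULL `Δ_a(U)` `γ₁`-coercive, `‖G₁(U)y‖ ≤ γ₁⁻¹‖y‖` for any `hpos`) with `∃ γ₁ ε₃` before `∀ m` (his proof verbatim on §8).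
MODEL / DECLARED READINGS.  (M1) as (E).  (M2) displayed: `hRS` (or unitarity + tracial `τ` + norming), `C_τ`, `M_φ`, `M_φ′`; proved: everything
else.  (M3) NOT HERE: uniformity in the SPACING `η` ∕ `L` (print's Thms 3.1–3.10, decay), the gauge step of p. 416 (small plaquettes ⇒ a gauge
with small bonds), analyticity in the background, the multi-level (3.16)∕(3.24), the Banach-norm (`NegSize`∕`Space115`) transfer.
HONEST SCOPE.  The OWNER's mechanism re-run; thresholds now numbers of `d, L, η, a, c₀, c₁, M_φ, M_φ′, C_τ` only; nothing of [B9] asserted; «NE9 ⇐ the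
named binders»; NE9 NOT PRINTED ∕ NOT PROVED; NOT summit progress (cell pub-balaban: spine PROVED 0/9; rung (B)+1 finite T⁴ — NOT infinite volume, NOT
mass gap, NOT Clay; HONEST DEPENDENCY: continuum YM on T⁴ ⇐ BetaPertH ∧ nine spine estimates (0/9 proved); BetaPertH ⇐ (D1) ∧ (D4) ∧ CAP+tail; G-an2-4
gates asym, D1 and NE2/3/4).  Unit `b2b-balaban-t4-ne9-formalise-leaf-03` (gen 59), INTENT I-ne9leaf03-g59-2 item (E′), after the OWNER's first
refusal; NEW file importing `B9Thm311SmallFieldCoercivityUniform`, `B9Thm311SmallFieldGreen` (hence (E), (H1)), `B9Eq319CentreLiftL2`,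
`B9Eq383QSemiLocal`; modifies nothing.  Net new unproved facts: 0.
-/

noncomputable section

open scoped InnerProductSpace ComplexConjugate BigOperators

namespace Literature.MathematicalPhysics.QuantumFieldTheory.Balaban1983to89.B9Thm311SmallFieldClosedUniform

open B4Sect5Torus (TSite)
open B9SectCLatticeCarrier (Bond)
open B7Prop1Explicit (U1 Wcx boxVec)
open B9Eq311L2Pairing (WL2)
open B9Eq319QprimeTorus (fineP centre weight)
open B9Eq319Onto (centreFun)
open B11Eq103H1Complex (SiteL2K BondL2K laplaceALatticeK)
open B9Eq310HessianOperator (adTransportW principalOpK)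
open B9Eq310DeltaPrime (plaqHolU)
open B9Eq326OperatorAssembly (RofU QprimeW)
open B9Eq315QTorus (perCfg cornerSite QtorusW laplaceAofBackground)
open B9Eq315QTorusOnto (liftSite perSite_liftSite)
open B5Eq172FlatCoercivity (hU1_one hreg_one)
open B9Eq384RemainderLetters (norm_adTransportW_sub_le)
open B9Thm311SmallFieldCoercivityUniform (exists_coercive_principal_of_small_field_uniform)
open B9Thm311SmallFieldClosed (norm_plaqHolU_sub_one_le hRS_of_unitary)
open B9Eq319CentreLiftL2 (norm_centreLift_QprimeW_sub_flat_le_linear)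
open B9Eq383QSemiLocal (norm_QtorusW_sub_flat_le_local)
open B9Ineq369CurvatureSmall (hpos_of_smallCurvature norm_inner_curvOp_self_le)
open B11Eq103H1Complex (G1LatticeK)
open B9Eq310HessianOperator (hessOp hessOp_apply curvOp)
open B9Eq3126GreenLetters (norm_greenK_le)

/-! ## §8 [B9] Thm 3.11 for the chain's assembled `Δ_a(U)`: `ε₂`, `ε₃` INDEPENDENT OF THE VOLUME -/

section ClosedUniform

variable {d : ℕ} (L : ℕ) [NeZero L] (hL : 1 ≤ L)
  {𝔸 : Type*} [NormedRing 𝔸] [NormedAlgebra ℂ 𝔸] [CompleteSpace 𝔸] [NormOneClass 𝔸]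
  {W : Type*} [NormedAddCommGroup W] [InnerProductSpace ℂ W] [FiniteDimensional ℂ W] (φ : W ≃ₗ[ℂ] 𝔸) {c₀ c₁ : ℝ} [Fact (0 < c₀)] [Fact (0 < c₁)]

/-- **[B9] THM 3.11, SECOND HALF, NO DISPLAYED REMAINDER, `(γ, ε₂)` INDEPENDENT OF THE VOLUME** — the OWNER's `B9Thm311SmallFieldClosed.exists_
coercive_principal_of_small_field₀` with the volume quantified INSIDE: ONE pair `γ, ε₂ > 0` (numbers of `d, L, η, a, c₀, c₁, M_φ, M_φ′`) such that
on EVERY lattice `TSite d (L·m)` and for EVERY background `U` of E162's data with `‖U(b) − 1‖ ≤ ε ≤ ε₂` and mutually adjoint transporters (`hRS`):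
`γ‖x‖² ≤ re⟨x, (D*D + DR(U)D* + aQ(U)*Q(U))x⟩`.  The averaging remainders of `B9Thm311SmallFieldCoercivityUniform` are DISCHARGED by the
volume-free leaf letters: the centre-lift `Q′`-letter `ρ := √(L^d)·d(L−1)·2^{d(L−1)}·ε_R` (`B9Eq319CentreLiftL2.norm_centreLift_QprimeW_sub_
flat_le_linear`, ne9-leaf-03) and `δ_Q := M_φ′M_φ√(2d·c₁∕c₀)·102(d+1)²L·ε` (`B9Eq383QSemiLocal.norm_QtorusW_sub_flat_le_local`, ne9-leaf-04);
`ε_R := 2M_φM_φ′ε` (`B9Eq384RemainderLetters.norm_adTransportW_sub_le`).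
[cite: Balaban1985BackgroundPropagators, Thm 3.11 p.416, (3.78)–(3.86) pp.406–407; Balaban1984PropagatorsI, Prop. 1.1 (1.90) p.33; Balaban1985Averaging, (124) p.36] -/
theorem exists_coercive_principal_of_small_field_uniform₀ {η : ℝ} (hη : η ≠ 0) {a : ℝ} (ha : 0 < a) {Mφ Mφ' : ℝ} (hMφ : 0 ≤ Mφ)
    (hMφ' : 0 ≤ Mφ') (hφ : ∀ w, ‖φ w‖ ≤ Mφ * ‖w‖) (hφ' : ∀ X, ‖φ.symm X‖ ≤ Mφ' * ‖X‖) :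
    ∃ γ ε₂ : ℝ, 0 < γ ∧ 0 < ε₂ ∧ ∀ (m : Fin d → ℕ) [∀ i, NeZero (fineP L m i)]
      (U : Bond d (fineP L m) → 𝔸ˣ) {α : ℝ} (hα1 : α ≤ 1 / 64)
      (hU1 : ∀ (x : B7Prop1Explicit.Site d) (κ : Fin d), perCfg (fineP L m) U x κ ∈ U1 𝔸)
      (hreg : ∀ (y : TSite d m) (κ : Fin d) (r : Fin d → Fin L), ‖((Wcx L (perCfg (fineP L m) U) (cornerSite L y) κ (boxVec L r) : 𝔸ˣ) : 𝔸) - 1‖ ≤ α)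
      {ε : ℝ}, 0 ≤ ε → ε ≤ ε₂ → (∀ b, ‖(U b : 𝔸) - 1‖ ≤ ε) →
      (∀ (b : Bond d (fineP L m)) (v u : W), ⟪adTransportW φ U b v, u⟫_ℂ = ⟪v, adTransportW φ (fun b => (U b)⁻¹) b u⟫_ℂ) →
      ∀ x : BondL2K ℂ d (fineP L m) c₀ W, γ * ‖x‖ ^ 2 ≤
        RCLike.re ⟪x, laplaceALatticeK ((η : ℂ))⁻¹ (adTransportW φ U) (adTransportW φ fun b => (U b)⁻¹) (principalOpK φ η U) (RofU L m φ η U)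
          (QtorusW L m hL φ U hα1 hU1 hreg (c₁ := c₁)) a x⟫_ℂ := by
  have hc₀ : 0 < c₀ := Fact.out
  have hc₁ : 0 < c₁ := Fact.out
  obtain ⟨γ, ε₀, hγ, hε₀, H⟩ :=
    exists_coercive_principal_of_small_field_uniform L hL φ (c₀ := c₀) (c₁ := c₁) hη ha hMφ hMφ' hφ hφ'
  -- the three linear rates, ALL volume-free: `εR = KR·ε`, `ρ = Cρ·εR` (for `εR ≤ 1`), `δ_Q = CQ·ε`
  obtain ⟨KR, hKRdef⟩ : ∃ KR : ℝ, KR = 2 * Mφ * Mφ' := ⟨_, rfl⟩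
  have hKR : 0 ≤ KR := by rw [hKRdef]; positivity
  obtain ⟨Cρ, hCρdef⟩ : ∃ Cρ : ℝ, Cρ = Real.sqrt ((L : ℝ) ^ d) * ((d * (L - 1) : ℕ) * 2 ^ (d * (L - 1))) := ⟨_, rfl⟩
  have hCρ : 0 ≤ Cρ := by rw [hCρdef]; positivity
  obtain ⟨CQ, hCQdef⟩ : ∃ CQ : ℝ, CQ = Mφ' * Mφ * Real.sqrt (2 * d * c₁ / c₀) * (102 * (d + 1) ^ 2 * L) := ⟨_, rfl⟩
  have hCQ : 0 ≤ CQ := by rw [hCQdef]; positivity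
  refine ⟨γ, min (1 / (KR + 1)) (ε₀ / (1 + Cρ * KR + CQ)), hγ, by positivity, ?_⟩
  intro m _ U α hα1 hU1 hreg ε hε hε₂ hUε hRS x
  have ht1 : ε ≤ 1 / (KR + 1) := hε₂.trans (min_le_left _ _)
  have ht2 : ε ≤ ε₀ / (1 + Cρ * KR + CQ) := hε₂.trans (min_le_right _ _)
  -- `U(b) ∈ U1` read off the periodic extension
  have hUb : ∀ b : Bond d (fineP L m), U b ∈ U1 𝔸 := fun b => by
    obtain ⟨y, κ⟩ := b
    have h := hU1 (liftSite y) κ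
    rwa [B9Eq315QTorus.perCfg_apply, perSite_liftSite] at h
  -- the transporters
  have hR : ∀ (b : Bond d (fineP L m)) (w : W), ‖adTransportW φ U b w - w‖ ≤ KR * ε * ‖w‖ := fun b w => by
    have h := norm_adTransportW_sub_le φ hφ hφ' hMφ' U b (hUb b) (hUε b) w
    rw [hKRdef]; linarith
  have hεR0 : 0 ≤ KR * ε := by positivity
  have hεR1 : KR * ε ≤ 1 := by
    refine (mul_le_mul_of_nonneg_left ht1 hKR).trans ?_
    rw [mul_one_div, div_le_one (by positivity)]; linarith
  -- (ρ) in the centre-lift currency, by ne9-leaf-03's `B9Eq319CentreLiftL2`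
  have hQ' : ∀ l : SiteL2K ℂ d (fineP L m) c₀ W,
      ‖(WL2.equiv ℂ (fun _ : TSite d (fineP L m) => c₀) W).symm (centreFun (weight L m) (centre L m)
        (QprimeW L m φ U l - QprimeW L m φ (fun _ : Bond d (fineP L m) => (1 : 𝔸ˣ)) l))‖ ≤ Cρ * (KR * ε) * ‖l‖ := fun l => by
    have h := norm_centreLift_QprimeW_sub_flat_le_linear L m φ U (c₀ := c₀) hεR0 hεR1 hR l
    rw [hCρdef]
    calc _ ≤ Real.sqrt ((L : ℝ) ^ d) * ((d * (L - 1) : ℕ) * 2 ^ (d * (L - 1))) * (KR * ε) * ‖l‖ := h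
      _ = Real.sqrt ((L : ℝ) ^ d) * ((d * (L - 1) : ℕ) * 2 ^ (d * (L - 1))) * (KR * ε) * ‖l‖ := rfl
  -- (δ_Q) by ne9-leaf-04's `B9Eq383QSemiLocal`
  have hQ : ∀ y : BondL2K ℂ d (fineP L m) c₀ W, ‖QtorusW L m hL φ U hα1 hU1 hreg (c₁ := c₁) y -
      QtorusW L m hL φ (fun _ => 1) (show (0 : ℝ) ≤ 1 / 64 by norm_num) (hU1_one L m) (hreg_one L m) (c₁ := c₁) y‖ ≤ CQ * ε * ‖y‖ := fun y => by
    refine (norm_QtorusW_sub_flat_le_local L m hL U hα1 hU1 hreg (show (0 : ℝ) ≤ 1 / 64 by norm_num) (hU1_one L m) (hreg_one L m) hε hUε φ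
      hMφ hφ hMφ' hφ' y).trans (le_of_eq ?_)
    rw [hCQdef]; ring
  -- the budget `ε + ρ + δ_Q ≤ ε₀`
  have hbudget : ε + Cρ * (KR * ε) + CQ * ε ≤ ε₀ := by
    have h1 : ε + Cρ * (KR * ε) + CQ * ε = ε * (1 + Cρ * KR + CQ) := by ring
    have h2 : ε * (1 + Cρ * KR + CQ) ≤ ε₀ := by
      have := mul_le_mul_of_nonneg_right ht2 (by positivity : (0 : ℝ) ≤ 1 + Cρ * KR + CQ)
      rwa [div_mul_cancel₀ _ (by positivity : (1 + Cρ * KR + CQ) ≠ 0)] at this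
    rw [h1]; exact h2
  exact H m U hα1 hU1 hreg hε (by positivity) (by positivity) hbudget hUb hUε hRS hQ' hQ x

variable [StarRing 𝔸] [NormedStarGroup 𝔸] [StarModule ℂ 𝔸]

/-- **[B9] THM 3.11 «Δ_a IS POSITIVE DEFINITE» FOR THE CHAIN'S ASSEMBLED `Δ_a(U)` AT EVERY SMALL FIELD OF EVERY VOLUME**: ONE `ε₃ > 0` (a number
of `d, L, η, a, c₀, c₁, M_φ, M_φ′, C_τ`) such that on EVERY lattice `TSite d (L·m)`, for EVERY background `U` of E162's data with `‖U(b) − 1‖ ≤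
ε ≤ ε₃` and mutually adjoint transporters, `0 < re⟨x, Δ_a(U)x⟩` for `x ≠ 0` — the displayed `hpos` of `B9Eq315QTorus.laplaceAofBackground` ∕
`Support/NE9CurChartOfBackground`, now with a volume-free threshold: the coercivity above + the curvature smallness
`B9Ineq369CurvatureSmall.hpos_of_smallCurvature` (plaquettes `4ε`-close to `1`, `B9Thm311SmallFieldClosed.norm_plaqHolU_sub_one_le`), whose
constant `32d·C_τ·M_φ²·(|η|^d∕c₀)·|η|⁻²` never saw the volume.  NOT print's uniformity in the SPACING (Thm 3.3's decay).
[cite: Balaban1985BackgroundPropagators, Thm 3.11 p.416, (3.69) p.404, (3.82)–(3.86) p.407; Balaban1984PropagatorsI, Prop. 1.1 (1.90) p.33] -/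
theorem laplaceAofBackground_pos_of_small_field_uniform {η : ℝ} (hη : η ≠ 0) {a : ℝ} (ha : 0 < a) {Mφ Mφ' : ℝ} (hMφ : 0 ≤ Mφ)
    (hMφ' : 0 ≤ Mφ') (hφ : ∀ w, ‖φ w‖ ≤ Mφ * ‖w‖) (hφ' : ∀ X, ‖φ.symm X‖ ≤ Mφ' * ‖X‖) (τ : 𝔸 →ₗ[ℂ] ℂ) {Cτ : ℝ}
    (hτ : ∀ X, ‖τ X‖ ≤ Cτ * ‖X‖) (hCτ : 0 ≤ Cτ) :
    ∃ ε₃ : ℝ, 0 < ε₃ ∧ ∀ (m : Fin d → ℕ) [∀ i, NeZero (fineP L m i)]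
      (U : Bond d (fineP L m) → 𝔸ˣ) {α : ℝ} (hα1 : α ≤ 1 / 64)
      (hU1 : ∀ (x : B7Prop1Explicit.Site d) (κ : Fin d), perCfg (fineP L m) U x κ ∈ U1 𝔸)
      (hreg : ∀ (y : TSite d m) (κ : Fin d) (r : Fin d → Fin L), ‖((Wcx L (perCfg (fineP L m) U) (cornerSite L y) κ (boxVec L r) : 𝔸ˣ) : 𝔸) - 1‖ ≤ α)
      {ε : ℝ}, 0 ≤ ε → ε ≤ ε₃ → (∀ b, ‖(U b : 𝔸) - 1‖ ≤ ε) →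
      (∀ (b : Bond d (fineP L m)) (v u : W), ⟪adTransportW φ U b v, u⟫_ℂ = ⟪v, adTransportW φ (fun b => (U b)⁻¹) b u⟫_ℂ) →
      ∀ x : BondL2K ℂ d (fineP L m) c₀ W, x ≠ 0 →
        0 < RCLike.re ⟪x, laplaceAofBackground L m hL φ U hα1 hU1 hreg τ η (c₀ := c₀) (c₁ := c₁) a x⟫_ℂ := by
  have hc₀ : 0 < c₀ := Fact.out
  obtain ⟨γ, ε₂, hγ, hε₂, H⟩ :=
    exists_coercive_principal_of_small_field_uniform₀ L hL φ (c₀ := c₀) (c₁ := c₁) hη ha hMφ hMφ' hφ hφ'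
  obtain ⟨Kc, hKcdef⟩ : ∃ Kc : ℝ, Kc = 32 * d * Cτ * Mφ ^ 2 * (|η| ^ d / c₀) * (‖((η : ℂ))⁻¹‖ ^ 2 * 4) := ⟨_, rfl⟩
  have hKc : 0 ≤ Kc := by rw [hKcdef]; positivity
  refine ⟨min ε₂ (γ / (Kc + 1) / 2), by positivity, ?_⟩
  intro m _ U α hα1 hU1 hreg ε hε hε₃ hUε hRS x hx
  have hUb : ∀ b : Bond d (fineP L m), ‖(U b : 𝔸)‖ ≤ 1 ∧ ‖(((U b)⁻¹ : 𝔸ˣ) : 𝔸)‖ ≤ 1 := fun b => by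
    obtain ⟨y, κ⟩ := b
    have h := hU1 (liftSite y) κ
    rw [B9Eq315QTorus.perCfg_apply, perSite_liftSite] at h
    exact B7Prop1Explicit.mem_U1.1 h
  have hpl : ∀ p : B9SectCLatticeCarrier.Plaq d (fineP L m), ‖(plaqHolU U p : 𝔸) - 1‖ ≤ 4 * ε :=
    norm_plaqHolU_sub_one_le (fun b => B7Prop1Explicit.mem_U1.2 (hUb b)) hUε
  have hγU := H m U hα1 hU1 hreg hε (hε₃.trans (min_le_left _ _)) hUε hRS
  -- the curvature constant `Kc·ε < γ`
  have hsmall : 32 * d * Cτ * Mφ ^ 2 * (|η| ^ d / c₀) * (‖((η : ℂ))⁻¹‖ ^ 2 * (4 * ε)) < γ := by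
    have h1 : 32 * d * Cτ * Mφ ^ 2 * (|η| ^ d / c₀) * (‖((η : ℂ))⁻¹‖ ^ 2 * (4 * ε)) = Kc * ε := by rw [hKcdef]; ring
    rw [h1]
    have h2 : ε ≤ γ / (Kc + 1) / 2 := hε₃.trans (min_le_right _ _)
    have h3 : Kc * ε ≤ Kc * (γ / (Kc + 1) / 2) := mul_le_mul_of_nonneg_left h2 hKc
    have h4 : Kc * (γ / (Kc + 1) / 2) < γ := by
      rw [mul_div_assoc', mul_div_assoc', div_div, div_lt_iff₀ (by positivity)]
      nlinarith
    exact h3.trans_lt h4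
  exact hpos_of_smallCurvature φ hτ hCτ hφ η hUb hpl (by positivity) _ _ _ _ _ a hγU hsmall x hx

/-- **THE SAME WITH `hRS` DISCHARGED BY THE MODEL LETTERS** (`B9Thm311SmallFieldClosed.hRS_of_unitary`): unitary bond variables, tracial `τ`,
norming `⟨φ⁻¹X, φ⁻¹Y⟩ = τ(X*Y)` ⇒ Thm 3.11 for the chain's `Δ_a(U)` at every small field of every volume, threshold independent of the volume.
[cite: Balaban1985BackgroundPropagators, Thm 3.11 p.416, (3.5) p.391; Balaban1985Variational, (18) p.277] -/
theorem laplaceAofBackground_pos_of_small_field_uniform_unitary {η : ℝ} (hη : η ≠ 0) {a : ℝ} (ha : 0 < a) {Mφ Mφ' : ℝ} (hMφ : 0 ≤ Mφ)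
    (hMφ' : 0 ≤ Mφ') (hφ : ∀ w, ‖φ w‖ ≤ Mφ * ‖w‖) (hφ' : ∀ X, ‖φ.symm X‖ ≤ Mφ' * ‖X‖) (τ : 𝔸 →ₗ[ℂ] ℂ) {Cτ : ℝ}
    (hτ : ∀ X, ‖τ X‖ ≤ Cτ * ‖X‖) (hCτ : 0 ≤ Cτ) (hτφ : ∀ X Y : 𝔸, ⟪φ.symm X, φ.symm Y⟫_ℂ = τ (star X * Y))
    (htr : ∀ X Y : 𝔸, τ (X * Y) = τ (Y * X)) :
    ∃ ε₃ : ℝ, 0 < ε₃ ∧ ∀ (m : Fin d → ℕ) [∀ i, NeZero (fineP L m i)]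
      (U : Bond d (fineP L m) → 𝔸ˣ) {α : ℝ} (hα1 : α ≤ 1 / 64)
      (hU1 : ∀ (x : B7Prop1Explicit.Site d) (κ : Fin d), perCfg (fineP L m) U x κ ∈ U1 𝔸)
      (hreg : ∀ (y : TSite d m) (κ : Fin d) (r : Fin d → Fin L), ‖((Wcx L (perCfg (fineP L m) U) (cornerSite L y) κ (boxVec L r) : 𝔸ˣ) : 𝔸) - 1‖ ≤ α)
      {ε : ℝ}, 0 ≤ ε → ε ≤ ε₃ → (∀ b, ‖(U b : 𝔸) - 1‖ ≤ ε) → (∀ b, star (U b : 𝔸) = (((U b)⁻¹ : 𝔸ˣ) : 𝔸)) →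
      ∀ x : BondL2K ℂ d (fineP L m) c₀ W, x ≠ 0 →
        0 < RCLike.re ⟪x, laplaceAofBackground L m hL φ U hα1 hU1 hreg τ η (c₀ := c₀) (c₁ := c₁) a x⟫_ℂ := by
  obtain ⟨ε₃, hε₃, H⟩ :=
    laplaceAofBackground_pos_of_small_field_uniform L hL φ (c₀ := c₀) (c₁ := c₁) hη ha hMφ hMφ' hφ hφ' τ hτ hCτ
  exact ⟨ε₃, hε₃, fun m _ U α hα1 hU1 hreg ε hε hεε₃ hUε hUstar x hx =>
    H m U hα1 hU1 hreg hε hεε₃ hUε (hRS_of_unitary φ τ hτφ htr U hUstar) x hx⟩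

/-! ## §9 The full `Δ_a(U)`: uniform coercivity `γ₁` and `‖G₁(U)‖ ≤ γ₁⁻¹` with `γ₁, ε₃` chosen before the volume -/

/-- **THE ASSEMBLED `Δ_a(U)` IS COERCIVE AT EVERY SMALL FIELD OF EVERY VOLUME WITH ONE `γ₁`** — the OWNER's (F) `B9Thm311SmallFieldGreen.exists_
coercive_laplaceA_of_small_field` with `∃ γ₁ ε₃` in front of `∀ m`: `exists_coercive_principal_of_small_field_uniform₀` minus the curvature form bound
`128d·C_τ·M_φ²(|η|^d∕c₀)|η|⁻²·ε ≤ γ∕2` (`B9Ineq369CurvatureSmall.norm_inner_curvOp_self_le`; m-free); `γ₁ = γ∕2`.  Proof = the owner's, verbatim.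
[cite: Balaban1985BackgroundPropagators, Thm 3.11 p.416, (3.69) p.404, p.392] -/
theorem exists_coercive_laplaceA_of_small_field_uniform {η : ℝ} (hη : η ≠ 0) {a : ℝ} (ha : 0 < a) {Mφ Mφ' : ℝ} (hMφ : 0 ≤ Mφ)
    (hMφ' : 0 ≤ Mφ') (hφ : ∀ w, ‖φ w‖ ≤ Mφ * ‖w‖) (hφ' : ∀ X, ‖φ.symm X‖ ≤ Mφ' * ‖X‖) (τ : 𝔸 →ₗ[ℂ] ℂ) {Cτ : ℝ}
    (hτ : ∀ X, ‖τ X‖ ≤ Cτ * ‖X‖) (hCτ : 0 ≤ Cτ) :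
    ∃ γ₁ ε₃ : ℝ, 0 < γ₁ ∧ 0 < ε₃ ∧ ∀ (m : Fin d → ℕ) [∀ i, NeZero (fineP L m i)]
      (U : Bond d (fineP L m) → 𝔸ˣ) {α : ℝ} (hα1 : α ≤ 1 / 64)
      (hU1 : ∀ (x : B7Prop1Explicit.Site d) (κ : Fin d), perCfg (fineP L m) U x κ ∈ U1 𝔸)
      (hreg : ∀ (y : TSite d m) (κ : Fin d) (r : Fin d → Fin L), ‖((Wcx L (perCfg (fineP L m) U) (cornerSite L y) κ (boxVec L r) : 𝔸ˣ) : 𝔸) - 1‖ ≤ α)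
      {ε : ℝ}, 0 ≤ ε → ε ≤ ε₃ → (∀ b, ‖(U b : 𝔸) - 1‖ ≤ ε) →
      (∀ (b : Bond d (fineP L m)) (v u : W), ⟪adTransportW φ U b v, u⟫_ℂ = ⟪v, adTransportW φ (fun b => (U b)⁻¹) b u⟫_ℂ) →
      ∀ x : BondL2K ℂ d (fineP L m) c₀ W, γ₁ * ‖x‖ ^ 2 ≤
        RCLike.re ⟪x, laplaceAofBackground L m hL φ U hα1 hU1 hreg τ η (c₀ := c₀) (c₁ := c₁) a x⟫_ℂ := by
  have hc₀ : 0 < c₀ := Fact.out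
  obtain ⟨γ, ε₂, hγ, hε₂, H⟩ :=
    exists_coercive_principal_of_small_field_uniform₀ L hL φ (c₀ := c₀) (c₁ := c₁) hη ha hMφ hMφ' hφ hφ'
  obtain ⟨Kc, hKcdef⟩ : ∃ Kc : ℝ, Kc = 32 * d * Cτ * Mφ ^ 2 * (|η| ^ d / c₀) * (‖((η : ℂ))⁻¹‖ ^ 2 * 4) := ⟨_, rfl⟩
  have hKc : 0 ≤ Kc := by rw [hKcdef]; positivity
  refine ⟨γ / 2, min ε₂ (γ / (Kc + 1) / 2), by positivity, by positivity, ?_⟩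
  intro m _ U α hα1 hU1 hreg ε hε hε₃ hUε hRS x
  have hUb : ∀ b : Bond d (fineP L m), ‖(U b : 𝔸)‖ ≤ 1 ∧ ‖(((U b)⁻¹ : 𝔸ˣ) : 𝔸)‖ ≤ 1 := fun b => by
    obtain ⟨y, κ⟩ := b
    have h := hU1 (liftSite y) κ
    rw [B9Eq315QTorus.perCfg_apply, perSite_liftSite] at h
    exact B7Prop1Explicit.mem_U1.1 h
  have hpl : ∀ p : B9SectCLatticeCarrier.Plaq d (fineP L m), ‖(plaqHolU U p : 𝔸) - 1‖ ≤ 4 * ε :=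
    norm_plaqHolU_sub_one_le (fun b => B7Prop1Explicit.mem_U1.2 (hUb b)) hUε
  have hγU := H m U hα1 hU1 hreg hε (hε₃.trans (min_le_left _ _)) hUε hRS x
  have hK := norm_inner_curvOp_self_le φ hτ hCτ hφ η hUb hpl (by positivity) x
  -- `Kc·ε ≤ γ/2`
  have hKε : 32 * d * Cτ * Mφ ^ 2 * (|η| ^ d / c₀) * (‖((η : ℂ))⁻¹‖ ^ 2 * (4 * ε)) ≤ γ / 2 := by
    have h1 : 32 * d * Cτ * Mφ ^ 2 * (|η| ^ d / c₀) * (‖((η : ℂ))⁻¹‖ ^ 2 * (4 * ε)) = Kc * ε := by rw [hKcdef]; ring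
    rw [h1]
    have h2 : ε ≤ γ / (Kc + 1) / 2 := hε₃.trans (min_le_right _ _)
    have h3 : Kc * ε ≤ Kc * (γ / (Kc + 1) / 2) := mul_le_mul_of_nonneg_left h2 hKc
    have h4 : Kc * (γ / (Kc + 1) / 2) ≤ γ / 2 := by
      rw [mul_div_assoc', mul_div_assoc', div_div, div_le_div_iff₀ (by positivity) (by norm_num)]
      nlinarith
    exact h3.trans h4
  -- split `Δ_a(U) = Δ_prin(U) + Δ′(U)`
  have hsplit : laplaceAofBackground L m hL φ U hα1 hU1 hreg τ η (c₀ := c₀) (c₁ := c₁) a x =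
      laplaceALatticeK ((η : ℂ))⁻¹ (adTransportW φ U) (adTransportW φ fun b => (U b)⁻¹) (principalOpK φ η U) (RofU L m φ η U)
        (QtorusW L m hL φ U hα1 hU1 hreg (c₁ := c₁)) a x + curvOp φ τ η U x := by
    show laplaceALatticeK ((η : ℂ))⁻¹ (adTransportW φ U) (adTransportW φ fun b => (U b)⁻¹) (hessOp φ η U τ) (RofU L m φ η U)
        (QtorusW L m hL φ U hα1 hU1 hreg (c₁ := c₁)) a x = _
    simp only [laplaceALatticeK, B11Eq103H1Complex.laplaceAK_apply, hessOp_apply]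
    abel
  rw [hsplit, inner_add_right, map_add]
  have h2 : -(32 * d * Cτ * Mφ ^ 2 * (|η| ^ d / c₀) * (‖((η : ℂ))⁻¹‖ ^ 2 * (4 * ε)) * ‖x‖ ^ 2) ≤ RCLike.re ⟪x, curvOp φ τ η U x⟫_ℂ := by
    have h := (RCLike.abs_re_le_norm ⟪x, curvOp φ τ η U x⟫_ℂ).trans hK
    rw [abs_le] at h
    exact h.1
  nlinarith [hγU, h2, hKε, sq_nonneg ‖x‖, mul_nonneg hKc hε]

/-- **`‖G₁(U)y‖ ≤ γ₁⁻¹‖y‖` AT EVERY SMALL FIELD OF EVERY VOLUME, ONE `γ₁`** — the OWNER's (F) `norm_G1_le_of_small_field` with `∃ γ₁ ε₃` before `∀ m`,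
for ANY positivity witness `hpos` (`B9Eq3126GreenLetters.norm_greenK_le`). [cite: Balaban1985BackgroundPropagators, Thm 3.4 p.400, Thm 3.11 p.416, (3.86) p.407] -/
theorem norm_G1_le_of_small_field_uniform {η : ℝ} (hη : η ≠ 0) {a : ℝ} (ha : 0 < a) {Mφ Mφ' : ℝ} (hMφ : 0 ≤ Mφ) (hMφ' : 0 ≤ Mφ')
    (hφ : ∀ w, ‖φ w‖ ≤ Mφ * ‖w‖) (hφ' : ∀ X, ‖φ.symm X‖ ≤ Mφ' * ‖X‖) (τ : 𝔸 →ₗ[ℂ] ℂ) {Cτ : ℝ} (hτ : ∀ X, ‖τ X‖ ≤ Cτ * ‖X‖) (hCτ : 0 ≤ Cτ) :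
    ∃ γ₁ ε₃ : ℝ, 0 < γ₁ ∧ 0 < ε₃ ∧ ∀ (m : Fin d → ℕ) [∀ i, NeZero (fineP L m i)]
      (U : Bond d (fineP L m) → 𝔸ˣ) {α : ℝ} (hα1 : α ≤ 1 / 64)
      (hU1 : ∀ (x : B7Prop1Explicit.Site d) (κ : Fin d), perCfg (fineP L m) U x κ ∈ U1 𝔸)
      (hreg : ∀ (y : TSite d m) (κ : Fin d) (r : Fin d → Fin L), ‖((Wcx L (perCfg (fineP L m) U) (cornerSite L y) κ (boxVec L r) : 𝔸ˣ) : 𝔸) - 1‖ ≤ α)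
      {ε : ℝ}, 0 ≤ ε → ε ≤ ε₃ → (∀ b, ‖(U b : 𝔸) - 1‖ ≤ ε) →
      (∀ (b : Bond d (fineP L m)) (v u : W), ⟪adTransportW φ U b v, u⟫_ℂ = ⟪v, adTransportW φ (fun b => (U b)⁻¹) b u⟫_ℂ) →
      ∀ (hpos : ∀ x : BondL2K ℂ d (fineP L m) c₀ W, x ≠ 0 →
          0 < RCLike.re ⟪x, laplaceAofBackground L m hL φ U hα1 hU1 hreg τ η (c₀ := c₀) (c₁ := c₁) a x⟫_ℂ)
        (y : BondL2K ℂ d (fineP L m) c₀ W), ‖G1LatticeK hpos y‖ ≤ γ₁⁻¹ * ‖y‖ := by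
  obtain ⟨γ₁, ε₃, hγ₁, hε₃, H⟩ :=
    exists_coercive_laplaceA_of_small_field_uniform L hL φ (c₀ := c₀) (c₁ := c₁) hη ha hMφ hMφ' hφ hφ' τ hτ hCτ
  refine ⟨γ₁, ε₃, hγ₁, hε₃, fun m _ U α hα1 hU1 hreg ε hε hεε₃ hUε hRS hpos y => ?_⟩
  exact norm_greenK_le hγ₁ (H m U hα1 hU1 hreg hε hεε₃ hUε hRS) hpos y

end ClosedUniform

end Literature.MathematicalPhysics.QuantumFieldTheory.Balaban1983to89.B9Thm311SmallFieldClosedUniform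

end
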